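import Summits.QuantumFields.YangMills.Theorems.PoincareLipschitzUniformSmallScaleEnergyOfFacts
import Summits.QuantumFields.YangMills.Theorems.PoincareLipschitzUniformSmallScaleEnergyOfTangentMapFact
import Summits.QuantumFields.YangMills.Theorems.PoincareLipschitzMinimisingMapCompactnessHolds
import HarnessLib

/-!
# Crux `BlockLipschitzL` (stmt-QuantumFields-23533) ∕ `HistoryTailL` (stmt-QuantumFields-19936), LINE 25 «CompactnessTransfer»,
# S1″ — «S1″ FROM ONE NAMED PRINTED FACT»: the compactness row (C) is a THEOREM; only one Schoen–Uhlenbeck row remains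

Cell `ym3-torus` (YM ladder rung R3 = continuum SU(2) Yang–Mills on T³ — a RUNG, NOT the Clay problem: not d = 4, not
infinite volume, not a mass gap); WIDTH helper seat `ym-ust-19936-w3` g15.  Helper `--supports stmt-QuantumFields-23533`; THEOREMS
ONLY (0 `def`, 0 `sorry`, default heartbeats).  The (C) row `Literature.Analysis.PDE.MinimisingMapCompactness` (Luckhaus 1988 ∕ Simon
1996 §2.9 Lemma 1) is DISCHARGED in the tree by seat w2 g13's lineage project
✓`…Theorems.PoincareLipschitzMinimisingMapCompactnessHolds.minimisingMapCompactness_holds` (Hardt–Kinderlehrer–Lin road; bricks by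
w2, w4, px5, px14, px15, px16, px22 and this seat's (C-b-β)∕(C-b knit)); with (M) monotonicity a theorem (✓`…MinimiserMonotonicity.hMono_holds`)
the registered stub S1″ now rests on ONE named printed fact, in either of two flavours:

* flavour (RS): `Literature.Analysis.PDE.MinimisingMapSmoothness` [SchoenUhlenbeck1984, Thm 2.7 (n = 3 ≤ d(3) = 3)] — via this seat's
  ✓`…UniformSmallScaleEnergyOfFacts.uniformSmallScaleEnergy_band_of_facts (hC) (hR)`;
* flavour (TM): `Literature.Analysis.PDE.MinimisingTangentMapConstant` [SchoenUhlenbeck1984, Prop. 1.2] — via seat px3 g9's (TM) re-cut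
  ✓`…UniformSmallScaleEnergyOfTangentMaps` and this seat's ✓`…UniformSmallScaleEnergyOfTangentMapFact.uniformSmallScaleEnergy_band_of_compactness_tangentMapFact (hC) (hT)`.

WHAT IS PROVED (ns `…Theorems.PoincareLipschitzUniformSmallScaleEnergyOfOneFact`) — four one-line instantiations at
`hC := minimisingMapCompactness_holds`:
* ★★★ `uniformSmallScaleEnergy_of_smoothnessFact (hR) : ⟨S1pp, the ∀Λ Sobolev text⟩`;
* ★★★ `uniformSmallScaleEnergy_band_of_smoothnessFact (hR) : ⟨registered v1.4-band `stub_uniformSmallScaleEnergy` VERBATIM⟩`;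
* ★★ `zeroDensity_of_tangentMapFact (hT) : ⟨(ZD)⟩`;
* ★★★ `uniformSmallScaleEnergy_band_of_tangentMapFact (hT) : ⟨registered v1.4-band `stub_uniformSmallScaleEnergy` VERBATIM⟩`.
HONEST SCOPE.  Each theorem is CONDITIONAL on its one named fact (SU84 Thm 2.7, resp. SU84 Prop. 1.2 — neither proved in the tree;
px3 g9's (TM-F) caps tangent-map densities at `3π`, the `8π` gap of [SU84 Lemma 1.1] stays named); S1″ stays OPEN on the registry
until one of them is discharged; `hHalvingBand`, K1, `MeanDeviationL`, `BlockLipschitzL`, `HistoryTailL` NOT proved.  YM₃ on T³ is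
rung R3, not Clay; YM gap NOT proved.
-/

set_option autoImplicit false

noncomputable section

open scoped BigOperators Topology
open MeasureTheory Set Filter Metric

namespace Summit.QuantumFields.YangMills.Theorems.PoincareLipschitzUniformSmallScaleEnergyOfOneFact

open Summit.QuantumFields.YangMills.Theorems.PoincareLipschitzUniformSmallScaleEnergyOfFacts
  (uniformSmallScaleEnergy_of_facts uniformSmallScaleEnergy_band_of_facts)
open Summit.QuantumFields.YangMills.Theorems.PoincareLipschitzUniformSmallScaleEnergyOfTangentMapFact
  (uniformSmallScaleEnergy_band_of_compactness_tangentMapFact zeroDensity_of_compactness_tangentMapFact)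
open Summit.QuantumFields.YangMills.Theorems.PoincareLipschitzMinimisingMapCompactnessHolds (minimisingMapCompactness_holds)
open Literature.Analysis.FunctionSpaces (HasWeakFDerivOn)

/-- ★★★ **S1″ (∀Λ Sobolev text) FROM THE ONE NAMED FACT `MinimisingMapSmoothness`** [SchoenUhlenbeck1984] — compactness is the tree
theorem `minimisingMapCompactness_holds`, monotonicity the tree theorem `hMono_holds`. [cite: SchoenUhlenbeck1984, Theorem 2.7 (p. 96)] -/
theorem uniformSmallScaleEnergy_of_smoothnessFact (hR : Literature.Analysis.PDE.MinimisingMapSmoothness) :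
    ∀ (Λ ε : ℝ), 0 < Λ → 0 < ε → ∃ r₁ : ℝ, 0 < r₁ ∧ r₁ ≤ 1 / 8 ∧
      ∀ (hQ : IsOpen {x : EuclideanSpace ℝ (Fin 3) | ∀ i : Fin 3, |x i| < 1}) (U : EuclideanSpace ℝ (Fin 3) → EuclideanSpace ℝ (Fin 4)) (G : EuclideanSpace ℝ (Fin 3) → (EuclideanSpace ℝ (Fin 3) →L[ℝ] EuclideanSpace ℝ (Fin 4))),
      Literature.Analysis.FunctionSpaces.HasWeakFDerivOn ⟨{x : EuclideanSpace ℝ (Fin 3) | ∀ i : Fin 3, |x i| < 1}, hQ⟩ volume U G →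
      (∀ x : EuclideanSpace ℝ (Fin 3), (∀ i : Fin 3, |x i| < 1) → ‖U x‖ = 1) →
      MeasureTheory.IntegrableOn (fun x => ∑ i : Fin 3, ‖G x (EuclideanSpace.single i (1:ℝ))‖ ^ 2)
        {x : EuclideanSpace ℝ (Fin 3) | ∀ i : Fin 3, |x i| < 1} →
      (∀ (V : EuclideanSpace ℝ (Fin 3) → EuclideanSpace ℝ (Fin 4)) (GV : EuclideanSpace ℝ (Fin 3) → (EuclideanSpace ℝ (Fin 3) →L[ℝ] EuclideanSpace ℝ (Fin 4))) (s : ℝ), s < 1 →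
        Literature.Analysis.FunctionSpaces.HasWeakFDerivOn ⟨{x : EuclideanSpace ℝ (Fin 3) | ∀ i : Fin 3, |x i| < 1}, hQ⟩ volume V GV →
        (∀ x : EuclideanSpace ℝ (Fin 3), (∀ i : Fin 3, |x i| < 1) → ‖V x‖ = 1) →
        MeasureTheory.IntegrableOn (fun x => ∑ i : Fin 3, ‖GV x (EuclideanSpace.single i (1:ℝ))‖ ^ 2)
        {x : EuclideanSpace ℝ (Fin 3) | ∀ i : Fin 3, |x i| < 1} →
        (∀ x : EuclideanSpace ℝ (Fin 3), (∃ i : Fin 3, s ≤ |x i|) → V x = U x) →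
        ∫ x in {x : EuclideanSpace ℝ (Fin 3) | ∀ i : Fin 3, |x i| < 1}, ∑ i : Fin 3, ‖G x (EuclideanSpace.single i (1:ℝ))‖ ^ 2 ≤
          ∫ x in {x : EuclideanSpace ℝ (Fin 3) | ∀ i : Fin 3, |x i| < 1}, ∑ i : Fin 3, ‖GV x (EuclideanSpace.single i (1:ℝ))‖ ^ 2) →
      ∫ x in {x : EuclideanSpace ℝ (Fin 3) | ∀ i : Fin 3, |x i| < 1}, ∑ i : Fin 3, ‖G x (EuclideanSpace.single i (1:ℝ))‖ ^ 2 ≤ Λ →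
      ∀ r : ℝ, 0 < r → r ≤ r₁ →
        ∫ x in {x : EuclideanSpace ℝ (Fin 3) | ∀ i : Fin 3, |x i| < r}, ∑ i : Fin 3, ‖G x (EuclideanSpace.single i (1:ℝ))‖ ^ 2 ≤ ε * r :=
  uniformSmallScaleEnergy_of_facts minimisingMapCompactness_holds hR

/-- ★★★ **THE REGISTERED S1″ TEXT FROM THE ONE NAMED FACT `MinimisingMapSmoothness`** (v1.4-band `stub_uniformSmallScaleEnergy`,
VERBATIM). [cite: SchoenUhlenbeck1984, Theorem 2.7 (p. 96)] -/
theorem uniformSmallScaleEnergy_band_of_smoothnessFact (hR : Literature.Analysis.PDE.MinimisingMapSmoothness) :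
    ∀ (Λ ε : ℝ), 0 < Λ → Λ ≤ 21 → 0 < ε → ∃ r₁ : ℝ, 0 < r₁ ∧ r₁ ≤ 1 / 8 ∧
      ∀ (hQ : IsOpen {x : EuclideanSpace ℝ (Fin 3) | ∀ i : Fin 3, |x i| < 1}) (U : EuclideanSpace ℝ (Fin 3) → EuclideanSpace ℝ (Fin 4)) (G : EuclideanSpace ℝ (Fin 3) → (EuclideanSpace ℝ (Fin 3) →L[ℝ] EuclideanSpace ℝ (Fin 4))),
      Literature.Analysis.FunctionSpaces.HasWeakFDerivOn ⟨{x : EuclideanSpace ℝ (Fin 3) | ∀ i : Fin 3, |x i| < 1}, hQ⟩ volume U G →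
      (∀ x : EuclideanSpace ℝ (Fin 3), (∀ i : Fin 3, |x i| < 1) → ‖U x‖ = 1) →
      MeasureTheory.IntegrableOn (fun x => ∑ i : Fin 3, ‖G x (EuclideanSpace.single i (1:ℝ))‖ ^ 2)
        {x : EuclideanSpace ℝ (Fin 3) | ∀ i : Fin 3, |x i| < 1} →
      (∀ (V : EuclideanSpace ℝ (Fin 3) → EuclideanSpace ℝ (Fin 4)) (GV : EuclideanSpace ℝ (Fin 3) → (EuclideanSpace ℝ (Fin 3) →L[ℝ] EuclideanSpace ℝ (Fin 4))) (s : ℝ), s < 1 →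
        Literature.Analysis.FunctionSpaces.HasWeakFDerivOn ⟨{x : EuclideanSpace ℝ (Fin 3) | ∀ i : Fin 3, |x i| < 1}, hQ⟩ volume V GV →
        (∀ x : EuclideanSpace ℝ (Fin 3), (∀ i : Fin 3, |x i| < 1) → ‖V x‖ = 1) →
        MeasureTheory.IntegrableOn (fun x => ∑ i : Fin 3, ‖GV x (EuclideanSpace.single i (1:ℝ))‖ ^ 2)
        {x : EuclideanSpace ℝ (Fin 3) | ∀ i : Fin 3, |x i| < 1} →
        (∀ x : EuclideanSpace ℝ (Fin 3), (∃ i : Fin 3, s ≤ |x i|) → V x = U x) →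
        ∫ x in {x : EuclideanSpace ℝ (Fin 3) | ∀ i : Fin 3, |x i| < 1}, ∑ i : Fin 3, ‖G x (EuclideanSpace.single i (1:ℝ))‖ ^ 2 ≤
          ∫ x in {x : EuclideanSpace ℝ (Fin 3) | ∀ i : Fin 3, |x i| < 1}, ∑ i : Fin 3, ‖GV x (EuclideanSpace.single i (1:ℝ))‖ ^ 2) →
      ∫ x in {x : EuclideanSpace ℝ (Fin 3) | ∀ i : Fin 3, |x i| < 1}, ∑ i : Fin 3, ‖G x (EuclideanSpace.single i (1:ℝ))‖ ^ 2 ≤ Λ →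
      ∀ r : ℝ, 0 < r → r ≤ r₁ →
        ∫ x in {x : EuclideanSpace ℝ (Fin 3) | ∀ i : Fin 3, |x i| < r}, ∑ i : Fin 3, ‖G x (EuclideanSpace.single i (1:ℝ))‖ ^ 2 ≤ ε * r :=
  uniformSmallScaleEnergy_band_of_facts minimisingMapCompactness_holds hR

/-- ★★ **(ZD) FROM THE ONE NAMED FACT `MinimisingTangentMapConstant`** [SchoenUhlenbeck1984, Prop. 1.2] — zero density at the
origin for every cube-minimiser of the class; compactness is the tree theorem `minimisingMapCompactness_holds`, monotonicity `hMono_holds`.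
[cite: SchoenUhlenbeck1984, Proposition 1.2 (p. 90); Simon1996, §2.4, §2.9 Lemma 1, §3.1] -/
theorem zeroDensity_of_tangentMapFact (hT : Literature.Analysis.PDE.MinimisingTangentMapConstant) :
    ∀ (hQ : IsOpen {x : EuclideanSpace ℝ (Fin 3) | ∀ i : Fin 3, |x i| < 1}) (U : EuclideanSpace ℝ (Fin 3) → EuclideanSpace ℝ (Fin 4)) (G : EuclideanSpace ℝ (Fin 3) → (EuclideanSpace ℝ (Fin 3) →L[ℝ] EuclideanSpace ℝ (Fin 4))),
      (HasWeakFDerivOn ⟨{x : EuclideanSpace ℝ (Fin 3) | ∀ i : Fin 3, |x i| < 1}, hQ⟩ volume U G ∧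
        (∀ x : EuclideanSpace ℝ (Fin 3), (∀ i : Fin 3, |x i| < 1) → ‖U x‖ = 1) ∧
        IntegrableOn (fun x => ∑ i : Fin 3, ‖G x (EuclideanSpace.single i (1:ℝ))‖ ^ 2) {x : EuclideanSpace ℝ (Fin 3) | ∀ i : Fin 3, |x i| < 1} ∧
        (∀ (y : EuclideanSpace ℝ (Fin 3)) (ρ : ℝ), 0 < ρ → closedBall y ρ ⊆ {x : EuclideanSpace ℝ (Fin 3) | ∀ i : Fin 3, |x i| < 1} →
          ∀ (W : EuclideanSpace ℝ (Fin 3) → EuclideanSpace ℝ (Fin 4)) (GW : EuclideanSpace ℝ (Fin 3) → (EuclideanSpace ℝ (Fin 3) →L[ℝ] EuclideanSpace ℝ (Fin 4))),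
          HasWeakFDerivOn ⟨{x : EuclideanSpace ℝ (Fin 3) | ∀ i : Fin 3, |x i| < 1}, hQ⟩ volume W GW →
          (∀ x : EuclideanSpace ℝ (Fin 3), (∀ i : Fin 3, |x i| < 1) → ‖W x‖ = 1) →
          IntegrableOn (fun x => ∑ i : Fin 3, ‖GW x (EuclideanSpace.single i (1:ℝ))‖ ^ 2) {x : EuclideanSpace ℝ (Fin 3) | ∀ i : Fin 3, |x i| < 1} →
          (∃ ρ' : ℝ, ρ' < ρ ∧ ∀ x : EuclideanSpace ℝ (Fin 3), x ∉ ball y ρ' → W x = U x) →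
          ∫ x in ball y ρ, ∑ i : Fin 3, ‖G x (EuclideanSpace.single i (1:ℝ))‖ ^ 2 ≤ ∫ x in ball y ρ, ∑ i : Fin 3, ‖GW x (EuclideanSpace.single i (1:ℝ))‖ ^ 2)) →
      ∀ η : ℝ, 0 < η → ∃ ρ : ℝ, 0 < ρ ∧ ρ < 1 ∧
        ρ⁻¹ * ∫ x in ball (0 : EuclideanSpace ℝ (Fin 3)) ρ, ∑ i : Fin 3, ‖G x (EuclideanSpace.single i (1:ℝ))‖ ^ 2 ≤ η :=
  zeroDensity_of_compactness_tangentMapFact minimisingMapCompactness_holds hT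

/-- ★★★ **THE REGISTERED S1″ TEXT FROM THE ONE NAMED FACT `MinimisingTangentMapConstant`** [SchoenUhlenbeck1984, Prop. 1.2]
(v1.4-band `stub_uniformSmallScaleEnergy`, VERBATIM) — compactness is the tree theorem `minimisingMapCompactness_holds`.
[cite: SchoenUhlenbeck1984, Proposition 1.2 (p. 90); Simon1996, §2.9 Lemma 1] -/
theorem uniformSmallScaleEnergy_band_of_tangentMapFact (hT : Literature.Analysis.PDE.MinimisingTangentMapConstant) :
    ∀ (Λ ε : ℝ), 0 < Λ → Λ ≤ 21 → 0 < ε → ∃ r₁ : ℝ, 0 < r₁ ∧ r₁ ≤ 1 / 8 ∧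
      ∀ (hQ : IsOpen {x : EuclideanSpace ℝ (Fin 3) | ∀ i : Fin 3, |x i| < 1}) (U : EuclideanSpace ℝ (Fin 3) → EuclideanSpace ℝ (Fin 4)) (G : EuclideanSpace ℝ (Fin 3) → (EuclideanSpace ℝ (Fin 3) →L[ℝ] EuclideanSpace ℝ (Fin 4))),
      Literature.Analysis.FunctionSpaces.HasWeakFDerivOn ⟨{x : EuclideanSpace ℝ (Fin 3) | ∀ i : Fin 3, |x i| < 1}, hQ⟩ volume U G →
      (∀ x : EuclideanSpace ℝ (Fin 3), (∀ i : Fin 3, |x i| < 1) → ‖U x‖ = 1) →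
      MeasureTheory.IntegrableOn (fun x => ∑ i : Fin 3, ‖G x (EuclideanSpace.single i (1:ℝ))‖ ^ 2)
        {x : EuclideanSpace ℝ (Fin 3) | ∀ i : Fin 3, |x i| < 1} →
      (∀ (V : EuclideanSpace ℝ (Fin 3) → EuclideanSpace ℝ (Fin 4)) (GV : EuclideanSpace ℝ (Fin 3) → (EuclideanSpace ℝ (Fin 3) →L[ℝ] EuclideanSpace ℝ (Fin 4))) (s : ℝ), s < 1 →
        Literature.Analysis.FunctionSpaces.HasWeakFDerivOn ⟨{x : EuclideanSpace ℝ (Fin 3) | ∀ i : Fin 3, |x i| < 1}, hQ⟩ volume V GV →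
        (∀ x : EuclideanSpace ℝ (Fin 3), (∀ i : Fin 3, |x i| < 1) → ‖V x‖ = 1) →
        MeasureTheory.IntegrableOn (fun x => ∑ i : Fin 3, ‖GV x (EuclideanSpace.single i (1:ℝ))‖ ^ 2)
        {x : EuclideanSpace ℝ (Fin 3) | ∀ i : Fin 3, |x i| < 1} →
        (∀ x : EuclideanSpace ℝ (Fin 3), (∃ i : Fin 3, s ≤ |x i|) → V x = U x) →
        ∫ x in {x : EuclideanSpace ℝ (Fin 3) | ∀ i : Fin 3, |x i| < 1}, ∑ i : Fin 3, ‖G x (EuclideanSpace.single i (1:ℝ))‖ ^ 2 ≤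
          ∫ x in {x : EuclideanSpace ℝ (Fin 3) | ∀ i : Fin 3, |x i| < 1}, ∑ i : Fin 3, ‖GV x (EuclideanSpace.single i (1:ℝ))‖ ^ 2) →
      ∫ x in {x : EuclideanSpace ℝ (Fin 3) | ∀ i : Fin 3, |x i| < 1}, ∑ i : Fin 3, ‖G x (EuclideanSpace.single i (1:ℝ))‖ ^ 2 ≤ Λ →
      ∀ r : ℝ, 0 < r → r ≤ r₁ →
        ∫ x in {x : EuclideanSpace ℝ (Fin 3) | ∀ i : Fin 3, |x i| < r}, ∑ i : Fin 3, ‖G x (EuclideanSpace.single i (1:ℝ))‖ ^ 2 ≤ ε * r :=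
  uniformSmallScaleEnergy_band_of_compactness_tangentMapFact minimisingMapCompactness_holds hT

end Summit.QuantumFields.YangMills.Theorems.PoincareLipschitzUniformSmallScaleEnergyOfOneFact

end
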